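import Summits.CriticalPhenomena.PercolationContinuityZ3.Theorems.Transplant.SkelPhiRootInputsG3X
import Summits.CriticalPhenomena.PercolationContinuityZ3.Theorems.Transplant.SkelPhiRootNumbersX
import HarnessLib

/-!
# N1 (the `{±1}` node), (R) column ((R6b) re-version under (L3), level-window form, x-family): **THE ROOT RESIDUE AT AN x-DIRECTION FROM THE INPUTS AND NUMBERS, ORIENTATION-AWARE KITS** —
# `Skelφ.rootOblTWAt_of_numbers3_x`: `rootOblTWAt_of_inputsG3_x` (kit level boxes asked only for `j ∈ [j₀, j₁]`) (kits through p1-g11's exit tables `pexRO`/`pexXO`) with the footprint tests instantiated as FINE footprint boxes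
# `FootBox lo hi w⊥ du (fineSkel φ t A_f n_L h_L vα vβ c₀ c₁ (D/2) (D/2) D ·)` and every ROOM discharged: the run origin `c_L` is a vertex with
# `φ c_L = φ t + y_L` (`exists_mem_graphBall_φ_eq`); the hop's landing box `[n_L, n_L] × [σh_L, σh_L + ℓ_L]` (`rootFrame_mem_box_of_sideHalf_same`); the
# bridge region / hop prism footprints near the root (`abs_fineSkel_le_of_near` + `footBox_of_abs_le`); the run's regions (⊆ its prism) and last core read by
# `footBox_of_runX_mem_Icc` through the sign-unified box `runX_sign_mem_Icc`; the cross link (`mem_scheduleN_core_iff` at core `0`); nonempty targets (the corner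
# `core1Lo`, the nominal core points `((k+1)n_L, 0)` realised at `φ`-offset `(σ(k+1)n_L, σ(k+1)h_L)`); the clearance from the prism's along-minimum.
# What remains: the Step-I″ inputs at every centre, the hop input, the seed facts, the two footprint-membership lemmas of the scheme (`hUfoot`/`hMfoot`),
# the kit blocks, counts, excess radius — and INTEGER INEQUALITIES over the frame data (the list stmt-g14 serves from the `NegB` floors).

builds on p205010 (kernel theorem, internal audit signed; external expert review pending) — nothing in this file uses p205010; nothing here is a claim about the open node.
Lane `prim-bschramm`, seat `prim-bschramm-p3` (gen 9; design owner + (R) owner); helper file (`--supports stmt-CriticalPhenomena-4575 --as helper`).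
[cite: KozmaNitzan2024, §4 p. 28 ((32) at the root), Lemma 11 (pp. 22–23), Lemma 12 (pp. 23–25)] [cite: MartineauTassion2017, §3.2, §4.3 Lemma 4.2]
-/

noncomputable section

open MeasureTheory ProbabilityTheory
open scoped ENNReal Classical

namespace Summit.CriticalPhenomena.PercolationContinuityZ3.Theorems

namespace Transplant

namespace Skelφ

open Literature.Probability.Percolation Literature.Probability.LatticeModels SimpleGraph GadgetSystem ProbeHistory HSiteScheme Contour KNCells
open Literature.Probability.Percolation.KozmaNitzan.Cells (oth sgOf sgOf_sign stepVec_apply_fst)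
open KNCells.KSchA KNLevels ChainPlanar ChainPara
open Literature.Barriers.CriticalPhenomena (graphBall mem_graphBall_self graphBall_mono)
open BoxProdZ2 (ConcRadiiG)
open Skel (winGraph RootOblTWAt excess)
open SkelI (tanOff)
open TwoAxis.Para (modulus)

variable {V : Type} [DecidableEq V] [Countable V] {G : SimpleGraph V} [G.LocallyFinite] {φ : V → Site 2}

/-! ## The root residue at an x-direction from the inputs and numbers (orientation-aware kits) -/

/-- **THE ROOT RESIDUE AT AN x-DIRECTION FROM THE INPUTS AND NUMBERS** (see the module docstring). Footprint tests: `FootBox flo fhi fw du (fineSkel … w)` (the root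
world) and `FootBox glo ghi gw du (fineSkel … w)` (the target box), read into the scheme by `hUfoot`/`hMfoot`; the run origin is any vertex `cL` with `φ cL = φ t + yL`
(exists by `exists_mem_graphBall_φ_eq`), its fine position is `(e₀, e₁) = (⌊(c₀λ₀(yL) + D/2)/D⌋, ⌊(c₁λ₁(yL) + D/2)/D⌋)` (`fineSkel_of_φ_eq`).
[cite: KozmaNitzan2024, §4 p. 28 ((32) at the root), Lemma 11 (pp. 22–23), Lemma 12 (pp. 23–25)] -/
theorem rootOblTWAt_of_numbers3_x {types : Finset V} (hlipφ : Lip G φ) (hstep : Steps G φ) (hfr : Frames G φ types) (hκ : CylConn G φ types)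
    {Δg : ℕ} (hΔg : ∀ v, G.degree v ≤ Δg)
    -- the scheme, its root, the direction
    (S : KSchA V ℕ) {t : V} (hroot : S.Γ.root = t) (du : MDir) {σ : ℤ} (hσ : σ = 1 ∨ σ = -1) {Rπ : ℕ}
    -- the fine map and the two footprint boxes, read into the scheme
    {Af vα vβ c0f c1f Df : ℤ} (hAf : 0 ≤ Af) {nL : ℕ} (hnL : 1 ≤ nL) (hL : ℤ) (hmf : 0 ≤ modulus nL hL vα vβ) (hc0 : 0 ≤ c0f) (hc1 : 0 ≤ c1f) (hDf : 0 < Df)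
    {flo fhi fw glo ghi gw : ℤ}
    (hUfoot : ∀ w ∈ graphBall G t Rπ, FootBox flo fhi fw du (fineSkel φ t Af nL hL vα vβ c0f c1f (Df / 2) (Df / 2) Df w) → w ∈ S.U0root du)
    (hMfoot : ∀ w ∈ graphBall G t Rπ, FootBox glo ghi gw du (fineSkel φ t Af nL hL vα vβ c0f c1f (Df / 2) (Df / 2) Df w) →
      w ∈ S.Γ.M S.Γ.a₀ ((0 : Site 2) + stepVec du))
    -- the pinned seed
    {A : Finset V} (htA : t ∈ A) (hAconn : ∀ a ∈ A, PathIn G (↑A : Set V) t a) {ρ : ℕ} (hAρ : ∀ a ∈ A, a ∈ graphBall G t ρ) (hρπ : ρ ≤ Rπ)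
    (hAQ : A ⊆ S.Γ.Q S.Γ.a₀ 0) {kb : ℕ} (hAφ : ∀ a ∈ A, |φ a 0 - φ t 0| ≤ kb)
    -- the bridge frame, the long run (x-run schedule in the x-frame at a vertex `cL` with `φ cL = φ t + yL`), level data
    (B : BridgePrm) (hB : BridgeOK B) {kq : ℕ} (hκL : hL.natAbs ≤ kq * nL) (ℓ' R's qB Nr Rl : ℕ) {yL : Site 2} (cL : V) (hcL : φ cL = φ t + yL)
    {RcL : ℕ} (hcLπ : cL ∈ graphBall G t RcL)
    (Rlev₁ N₁ j₀₁ j₁₁ Rlev₂ N₂ j₀₂ j₁₂ : ℕ) (hRl₁ : Rlev₁ + 1 ≤ B.R') (hRl₂ : Rlev₂ + 1 ≤ R's) (hj₁ : j₁₁ ≤ Rlev₁) (hj₂ : j₁₂ ≤ Rlev₂)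
    -- ROOM NUMBERS (a): the hop's landing box inside core `0` of the bridge; the long prism radius inside the window
    (hB0 : Finset.Icc (pt nL (σ * hL)) (pt nL (σ * hL + ℓ')) ⊆ Finset.Icc B.B₀lo B.B₀hi) (hRlπ : Rl ≤ Rπ)
    -- ROOM NUMBERS (b): near-root reach `sR` of the bridge region and of the hop prism, read by `kR` into the root-world box
    {sR kR : ℤ} (hsR : ∀ x ∈ Finset.Icc B.regionLo B.regionHi, ∀ i, |x i| ≤ sR) (hsQ : (pgScale nL hL (3 * ℓ') : ℤ) ≤ sR)
    (hkR0 : c0f * (|Af| * (|vβ| + |vα|) * sR) ≤ kR * Df) (hkR1 : c1f * (|Af| * (|(nL : ℤ)| + |hL|) * sR) ≤ kR * Df)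
    (hfR : flo ≤ -kR ∧ kR ≤ fhi ∧ kR ≤ fw)
    -- ROOM NUMBERS (c): the run's prism and last core as boxes of the x-frame, and their readings into the two footprint boxes (sign-unified)
    {paLo pbLo paHi pbHi laLo lbLo laHi lbHi : ℤ} (hprism : (xRunSched nL ℓ' hL R's qB Nr).prism ⊆ Finset.Icc (pt paLo pbLo) (pt paHi pbHi))
    (hlastc : (xRunSched nL ℓ' hL R's qB Nr).core (Nr + 1) ⊆ Finset.Icc (pt laLo lbLo) (pt laHi lbHi))
    {PLO PHI LLO LHI : Site 2}
    (hP0 : PLO 0 ≤ TwoAxis.Para.coarse c0f (Df / 2) Df (TwoAxis.Para.lam0 Af vα vβ yL) +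
      (c0f * (Af * (modulus nL hL vα vβ * (min (σ * paLo) (σ * paHi)) -
        max (vα * ((shearUnit nL hL : ℤ) * (min (σ * pbLo) (σ * pbHi) - 1))) (vα * ((shearUnit nL hL : ℤ) * (max (σ * pbLo) (σ * pbHi)) + shearUnit nL hL - 1))) / nL)) / Df)
    (hP1 : TwoAxis.Para.coarse c0f (Df / 2) Df (TwoAxis.Para.lam0 Af vα vβ yL) +
      (c0f * (Af * (modulus nL hL vα vβ * (max (σ * paLo) (σ * paHi)) -
        min (vα * ((shearUnit nL hL : ℤ) * (min (σ * pbLo) (σ * pbHi) - 1))) (vα * ((shearUnit nL hL : ℤ) * (max (σ * pbLo) (σ * pbHi)) + shearUnit nL hL - 1))) / nL)) / Df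
        + 1 ≤ PHI 0)
    (hP2 : PLO 1 ≤ TwoAxis.Para.coarse c1f (Df / 2) Df (TwoAxis.Para.lam1 Af nL hL yL) + (c1f * (Af * ((shearUnit nL hL : ℤ) * (min (σ * pbLo) (σ * pbHi) - 1)))) / Df)
    (hP3 : TwoAxis.Para.coarse c1f (Df / 2) Df (TwoAxis.Para.lam1 Af nL hL yL) +
      (c1f * (Af * ((shearUnit nL hL : ℤ) * (max (σ * pbLo) (σ * pbHi)) + shearUnit nL hL - 1))) / Df + 1 ≤ PHI 1)
    (hPf₁ : sgOf du = 1 → flo ≤ PLO du.1 ∧ PHI du.1 ≤ fhi) (hPf₂ : sgOf du = -1 → flo ≤ -PHI du.1 ∧ -PLO du.1 ≤ fhi)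
    (hPf₃ : -fw ≤ PLO (oth du.1) ∧ PHI (oth du.1) ≤ fw)
    (hL0 : LLO 0 ≤ TwoAxis.Para.coarse c0f (Df / 2) Df (TwoAxis.Para.lam0 Af vα vβ yL) +
      (c0f * (Af * (modulus nL hL vα vβ * (min (σ * laLo) (σ * laHi)) -
        max (vα * ((shearUnit nL hL : ℤ) * (min (σ * lbLo) (σ * lbHi) - 1))) (vα * ((shearUnit nL hL : ℤ) * (max (σ * lbLo) (σ * lbHi)) + shearUnit nL hL - 1))) / nL)) / Df)
    (hL1 : TwoAxis.Para.coarse c0f (Df / 2) Df (TwoAxis.Para.lam0 Af vα vβ yL) +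
      (c0f * (Af * (modulus nL hL vα vβ * (max (σ * laLo) (σ * laHi)) -
        min (vα * ((shearUnit nL hL : ℤ) * (min (σ * lbLo) (σ * lbHi) - 1))) (vα * ((shearUnit nL hL : ℤ) * (max (σ * lbLo) (σ * lbHi)) + shearUnit nL hL - 1))) / nL)) / Df
        + 1 ≤ LHI 0)
    (hL2 : LLO 1 ≤ TwoAxis.Para.coarse c1f (Df / 2) Df (TwoAxis.Para.lam1 Af nL hL yL) + (c1f * (Af * ((shearUnit nL hL : ℤ) * (min (σ * lbLo) (σ * lbHi) - 1)))) / Df)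
    (hL3 : TwoAxis.Para.coarse c1f (Df / 2) Df (TwoAxis.Para.lam1 Af nL hL yL) +
      (c1f * (Af * ((shearUnit nL hL : ℤ) * (max (σ * lbLo) (σ * lbHi)) + shearUnit nL hL - 1))) / Df + 1 ≤ LHI 1)
    (hLg₁ : sgOf du = 1 → glo ≤ LLO du.1 ∧ LHI du.1 ≤ ghi) (hLg₂ : sgOf du = -1 → glo ≤ -LHI du.1 ∧ -LLO du.1 ≤ ghi)
    (hLg₃ : -gw ≤ LLO (oth du.1) ∧ LHI (oth du.1) ≤ gw)
    -- ROOM NUMBERS (d): the cross link (bridge core `1` read into the run's core `0`), the clearance, the reaches inside the window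
    (hxa : ∀ x ∈ Finset.Icc B.core1Lo B.core1Hi, |x 0 - σ * yL 0| ≤ qB)
    (hxb : ∀ x ∈ Finset.Icc B.core1Lo B.core1Hi,
      |σ * ((nL : ℤ) * (x 1 - yL 1) - hL * (σ * x 0 - yL 0))| + shearUnit nL hL ≤ ((nL * ℓ' / shearUnit nL hL + 1 : ℕ) : ℤ) * shearUnit nL hL)
    (hclr : (kb : ℤ) < paLo + σ * yL 0) (hclr₁ : (kb : ℤ) < B.B₀lo 0 - B.R' - B.pr)
    (hπ1 : (B.core1Lo 0).natAbs + (B.core1Lo 1).natAbs ≤ Rπ) (hπ2 : RcL + (Nr + 1) * shearUnit nL hL ≤ Rπ)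
    -- the hop: the root's own long x side half (upper half), an input valid for `P_{S.p}` with the pinned seed as SEED
    {Δ' : ℕ} {δr : ℕ → ℝ} {η : ℝ} (hδr : 0 < δr (0 + 1 + Nr))
    (hlink : 1 - δr (0 + 1 + Nr) < (bondPercolation G S.p).real
      (linkIn (↑(pgramPrismFin G φ t nL hL (3 * ℓ') Rl) : Set V) A (pgSideHalfW G φ t nL hL ℓ' Rl σ 1)))
    -- counts and the accuracy split
    (hcount₁ : 1 / (1 - (S.p : ℝ)) ^ (Δ' * N₁) ≤ δr (0 + 1 + Nr) * ((Finset.Icc j₀₁ j₁₁).card : ℝ))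
    (hcount₂ : 1 / (1 - (S.p : ℝ)) ^ (Δ' * N₂) ≤ δr (0 + 1 + Nr) * ((Finset.Icc j₀₂ j₁₂).card : ℝ))
    (hη : η ≤ δr (0 + 1 + Nr) / 2)
    -- THE KITS: constants of the bridge kit `Pb` and of the run kit `Pr`, short region, zone family, short pieces
    (Pb Pr : ApronPrm) {Mz Rs Kmaxb KCmaxb Kmaxr KCmaxr rsb rsr cSb cSr cU r₁ r₂ Rb : ℕ}
    (hPNb : 1 ≤ Pb.N) (hAb : Pb.A = (Mz : ℤ) + 2)
    (hd1b : Pb.W + Pb.ℓ ≤ Pb.d) (hD1b : Pb.W + Pb.ℓ + Pb.d + 2 ≤ shellD Pb) (hD2b : Pb.ℓ + Rs + Pb.d + 3 ≤ shellD Pb) (hDρb : Rs + 1 ≤ shellD Pb)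
    (hℓb : 1 ≤ Pb.ℓ) (hWb : Rs + Pb.ℓ ≤ Pb.W) (hKmaxb : shellD Pb + Pb.W ≤ Kmaxb) (hKCmaxb : shellD Pb + Mz + 1 ≤ KCmaxb)
    (hR'b : cylRadMax G φ types Pb.ℓ (Rs + KCmaxb + (Pb.W + Kmaxb)) ≤ Pb.R')
    (hwideb : ∀ j, j₀₁ ≤ j → j ≤ j₁₁ → ∀ i, (B.B₀lo - (j : Site 2)) i + 2 * tanOff Pb.ℓs Pb.M ≤ (B.B₀hi + (j : Site 2)) i)
    (hdwb : ∀ j, j₀₁ ≤ j → j ≤ j₁₁ → ∀ i, (B.B₀lo - (j : Site 2)) i + (Pb.d + 2 : ℕ) ≤ (B.B₀hi + (j : Site 2)) i)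
    (hDwb : ∀ j, j₀₁ ≤ j → j ≤ j₁₁ → ∀ i, (B.B₀lo - (j : Site 2)) i + ((shellD Pb + 1 + Pb.d + KCmaxb + Rs : ℕ) : ℤ) ≤ (B.B₀hi + (j : Site 2)) i)
    (hTb : (Pb.W : ℤ) + Kmaxb + Pb.ℓ + 1 ≤ tanOff Pb.ℓs Pb.M) (hT'b : (shellD Pb : ℤ) + KCmaxb + Rs ≤ tanOff Pb.ℓs Pb.M)
    (hr₀b : Pb.N * (tanOff Pb.ℓs Pb.M + 2) + Pb.N * Pb.d + (Pb.W + Kmaxb + Pb.R') + (KCmaxb + Rs) ≤ Pb.r₀) (hRb₀ : Pb.r₀ ≤ Rπ)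
    (hrsb : 2 * (1 + Pb.N * (tanOff Pb.ℓs Pb.M + 2) + Pb.N * Pb.d + (Pb.W + Kmaxb + Pb.R') + (KCmaxb + Rs)) ≤ rsb)
    (hcSb : (Pb.N + 1) * (tanOff Pb.ℓs Pb.M + 1) + (Pb.N + 1) * Pb.d + (2 * Pb.W + 1) * (Kmaxb + 1) * (Δg + 1) ^ Pb.R' ≤ cSb)
    (hEb : j₁₁ + (Pb.N * (tanOff Pb.ℓs Pb.M + 1) + Pb.N * Pb.d + KCmaxb) ≤ B.R')
    (hreachb : r₁ + (Pb.N * (tanOff Pb.ℓs Pb.M + 1) + Pb.N * Pb.d + KCmaxb) ≤ Pb.r₀) (hr₁ : Rb ≤ r₁) (hr₁R : r₁ ≤ Rπ)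
    (hPNr : kq + 3 ≤ Pr.N) (hAr : Pr.A = (Mz + 1 : ℕ) * (shearUnit nL hL : ℤ) + 1)
    (hd1r : Pr.W + Pr.ℓ ≤ Pr.d) (hD1r : Pr.W + Pr.ℓ + Pr.d + 2 ≤ shellD Pr) (hD2r : Pr.ℓ + Rs + Pr.d + 3 ≤ shellD Pr) (hDρr : Rs + 1 ≤ shellD Pr)
    (hℓr : 1 ≤ Pr.ℓ) (hWr : Rs + Pr.ℓ ≤ Pr.W) (hKmaxr : (shellD Pr + Pr.W) * (kq + 1) ≤ Kmaxr) (hKCmaxr : (shellD Pr + Mz + 1) * (kq + 1) ≤ KCmaxr)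
    (hR'r : cylRadMax G φ types Pr.ℓ (Rs + KCmaxr + (Pr.W + Kmaxr)) ≤ Pr.R')
    (hwider : ∀ k ≤ Nr, ∀ j, j₀₂ ≤ j → j ≤ j₁₂ → ∀ i, ((xRunSched nL ℓ' hL R's qB Nr).lo k - (j : Site 2)) i + 2 * tanOff Pr.ℓs Pr.M ≤
      ((xRunSched nL ℓ' hL R's qB Nr).hi k + (j : Site 2)) i)
    (hdwr : ∀ k ≤ Nr, ∀ j, j₀₂ ≤ j → j ≤ j₁₂ → ∀ i, ((xRunSched nL ℓ' hL R's qB Nr).lo k - (j : Site 2)) i + (Pr.d + 2 : ℕ) ≤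
      ((xRunSched nL ℓ' hL R's qB Nr).hi k + (j : Site 2)) i)
    (hDwr : ∀ k ≤ Nr, ∀ j, j₀₂ ≤ j → j ≤ j₁₂ → ∀ i, ((xRunSched nL ℓ' hL R's qB Nr).lo k - (j : Site 2)) i + ((shellD Pr + 1 + Pr.d + KCmaxr + Rs : ℕ) : ℤ) ≤
      ((xRunSched nL ℓ' hL R's qB Nr).hi k + (j : Site 2)) i)
    (hTr : (Pr.W : ℤ) + Kmaxr + Pr.ℓ + 1 ≤ tanOff Pr.ℓs Pr.M) (hT'r : (shellD Pr : ℤ) + KCmaxr + Rs ≤ tanOff Pr.ℓs Pr.M)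
    (hr₀r : Pr.N * (tanOff Pr.ℓs Pr.M + 2) + Pr.N * Pr.d + (Pr.W + Kmaxr + Pr.R') + (KCmaxr + Rs) ≤ Pr.r₀) (hRr₀ : Pr.r₀ ≤ Rπ)
    (hrsr : 2 * (1 + Pr.N * (tanOff Pr.ℓs Pr.M + 2) + Pr.N * Pr.d + (Pr.W + Kmaxr + Pr.R') + (KCmaxr + Rs)) ≤ rsr)
    (hcSr : (Pr.N + 1) * (tanOff Pr.ℓs Pr.M + 1) + (Pr.N + 1) * Pr.d + (2 * Pr.W + 1) * (Kmaxr + 1) * (Δg + 1) ^ Pr.R' ≤ cSr)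
    (hEr : j₁₂ + (Pr.N * (tanOff Pr.ℓs Pr.M + 1) + Pr.N * Pr.d + KCmaxr) ≤ R's)
    (hreachr : r₂ + (Pr.N * (tanOff Pr.ℓs Pr.M + 1) + Pr.N * Pr.d + KCmaxr) ≤ Pr.r₀) (hr₂ : Rl ≤ r₂) (hr₂R : r₂ ≤ Rπ)
    (QK : ShortPcO V) (hRgRs : ∀ c, QK.RS c ≤ Rs) (hRgcard : ∀ c, (RgO G φ QK c).card ≤ cU) (hcU1 : 1 ≤ cU)
    (hnSK : ∀ c, 22 * Mz + 58 ≤ QK.nS c) (hκSK : ∀ c, |QK.hS c| ≤ 10 * (QK.nS c : ℤ)) (hℓSK : ∀ c, 24 * Mz + 64 ≤ QK.ℓS c) (hκL10 : |hL| ≤ 10 * (nL : ℤ))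
    (Λc : V → ℕ → Finset V) (kz : ℕ) (hkn : ∀ c, Λc c kz ⊆ Λc c Mz) (hΛ : ∀ c, ∀ v ∈ Λc c Mz, v ∈ RgO G φ QK c ∧ φ v - φ c ∈ box 2 Mz)
    (hZ : ∀ c, (↑(Λc c Mz) : Set V) ⊆ cyl φ c Mz) (hMz : Mz < nL)
    -- the bridge stride at every centre: region, piece, readings, off the zone
    (Qb Fb : V → Finset V)
    (hQb : ∀ c, ∀ w ∈ Qb c, w ∈ graphBall G c Rb ∧
      rootFrame φ t σ w ∈ Finset.Icc (rootFrame φ t σ c - ((B.pr : ℕ) : Site 2)) (rootFrame φ t σ c + ((B.pr : ℕ) : Site 2)))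
    (hFb : ∀ c, ∀ w ∈ Fb c, w ∈ Qb c ∧ rootFrame φ t σ w ∈ Finset.Icc (rootFrame φ t σ c + B.dlo) (rootFrame φ t σ c + B.dhi))
    (hFZ : ∀ c, Disjoint (Fb c) (Λc c Mz))
    -- contact-count budgets of the two kits
    (kk₁ kk₂ : ℕ) (hkN₁ : kk₁ * (Δg + 1) ^ (2 * rsb) ≤ N₁) (hkN₂ : kk₂ * (Δg + 1) ^ (2 * rsr) ≤ N₂)
    (hk₁ : (1 - (S.p : ℝ) ^ (1 + Δg * cSb + cSb * cU)) ^ kk₁ ≤ δr (0 + 1 + Nr)) (hk₂ : (1 - (S.p : ℝ) ^ (1 + Δg * cSr + cSr * cU)) ^ kk₂ ≤ δr (0 + 1 + Nr))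
    -- THE STEP-I″ INPUTS AT EVERY CENTRE (all for `P_q`)
    (hzone : ∀ c, 1 - δr (0 + 1 + Nr) ^ 2 < (bondPercolation G S.p).real (UniqZone.zone G (Λc c) kz Mz))
    (hexitb : ∀ c (i : Fin 2) (σ₀ : ℤˣ), 1 - δr (0 + 1 + Nr) ^ 2 < (bondPercolation G S.p).real
      (linkIn (↑(RgO G φ QK c) : Set V) (Λc c kz) (pexRO G φ QK Mz Pb.A σ i σ₀ c)))
    (hexitr : ∀ c (i : Fin 2) (σ₀ : ℤˣ), 1 - δr (0 + 1 + Nr) ^ 2 < (bondPercolation G S.p).real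
      (linkIn (↑(RgO G φ QK c) : Set V) (Λc c kz) (pexXO G φ QK Mz nL hL Pr.A σ i σ₀ c)))
    (hbridge : ∀ c, 1 - δr (0 + 1 + Nr) ^ 2 < (bondPercolation G S.p).real (linkIn (↑(Qb c) : Set V) (Λc c kz) (Fb c)))
    (hlong : ∀ c (τ : ℤ), τ = 1 ∨ τ = -1 → 1 - δr (0 + 1 + Nr) ^ 2 < (bondPercolation G S.p).real
      (linkIn (pgramPrism G φ c nL hL (3 * ℓ') Rl) (Λc c kz) (pgSideHalfW G φ c nL hL ℓ' Rl σ (σ * τ))))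
    -- the excess radius at depth `ρ + 1` (conclusion of `exists_excess_radius_uniform`), below both rim radii
    {R₁ : ℕ}
    (hR₁ : ∀ R', R₁ ≤ R' → ∀ (Rw : ℕ) (D' B' : Finset V), (∀ d ∈ D', d ∈ graphBall G t Rw) →
      (∀ d ∈ D', ∀ d' ∈ D', φ d - φ d' ∈ box 2 (2 * Rπ)) → B' ⊆ D' → (∀ a ∈ B', a ∈ graphBall G t (ρ + 1)) →
        (bondPercolation G S.p).real (excess G t R' D' B') ≤ η)
    (hR₁b : R₁ ≤ Rπ - Pb.r₀) (hR₁r : R₁ ≤ Rπ - Pr.r₀) :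
    RootOblTWAt G S Δ' δr du := by
  set FS := fineSkel φ t Af nL hL vα vβ c0f c1f (Df / 2) (Df / 2) Df with hFS
  set SN := xRunSched nL ℓ' hL R's qB Nr with hSN
  have hU0 : 0 < (shearUnit nL hL : ℤ) := shearUnit_pos hnL hL
  have hσabs : |σ| = 1 := by rcases hσ with h | h <;> simp [h]
  have hσsq : σ * σ = 1 := by rcases hσ with rfl | rfl <;> simp
  obtain ⟨he0, he1⟩ := fineSkel_of_φ_eq (φ := φ) t (Af := Af) (nL := nL) (hL := hL) (vα := vα) (vβ := vβ) (c0f := c0f) (c1f := c1f) (Df := Df) hcL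
  -- run coordinates at `cL` versus root-frame coordinates
  have hrun0 : ∀ w, runX φ cL nL hL σ w 0 = rootFrame φ t σ w 0 - σ * yL 0 := fun w => by
    rw [runX_zero, relCoord_apply, rootFrame_apply_zero, hcL, Pi.add_apply]; ring
  have hrun1 : ∀ w, runX φ cL nL hL σ w 1 = (σ * ((nL : ℤ) * (rootFrame φ t σ w 1 - yL 1) - hL * (σ * rootFrame φ t σ w 0 - yL 0))) / (shearUnit nL hL : ℤ) :=
    fun w => by
    rw [runX_one, shearCoord_apply, rootFrame_apply_zero, rootFrame_apply_one, hcL, Pi.add_apply, Pi.add_apply]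
    congr 1
    have : σ * (σ * (φ w 0 - φ t 0)) = φ w 0 - φ t 0 := by rw [← mul_assoc, hσsq, one_mul]
    rw [this]; ring
  -- (1) near-root footprints: the bridge region and the hop prism
  have hnear : ∀ w, |φ w 0 - φ t 0| ≤ sR → |φ w 1 - φ t 1| ≤ sR → FootBox flo fhi fw du (FS w) := fun w h0 h1 => by
    obtain ⟨k0, k1⟩ := abs_fineSkel_le_of_near (φ := φ) t hDf hc0 hc1 hkR0 hkR1 h0 h1
    exact footBox_of_abs_le_both k0 k1 hfR.1 hfR.2.1 hfR.2.2
  have hfoot₁ : ∀ w ∈ graphBall G t Rπ, rootFrame φ t σ w ∈ Finset.Icc B.regionLo B.regionHi → FootBox flo fhi fw du (FS w) := fun w _ hw => by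
    obtain ⟨h0, h1⟩ := abs_sub_le_of_rootFrame_mem t hσ hsR hw
    exact hnear w h0 h1
  have hQfoot : ∀ w ∈ pgramPrismFin G φ t nL hL (3 * ℓ') Rl, FootBox flo fhi fw du (FS w) := fun w hw => by
    have hw' := (mem_pgramPrismFin G φ).1 hw
    have hb := rootFrame_mem_box_of_prism t hσ hw'
    rw [rootFrame_self] at hb
    have hs : ∀ x ∈ Finset.Icc ((0 : Site 2) - ((pgScale nL hL (3 * ℓ') : ℕ) : Site 2)) (0 + ((pgScale nL hL (3 * ℓ') : ℕ) : Site 2)), ∀ i, |x i| ≤ sR := by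
      intro x hx i
      rw [Finset.mem_Icc, Pi.le_def, Pi.le_def] at hx
      have h1 := hx.1 i; have h2 := hx.2 i
      simp only [Pi.sub_apply, Pi.add_apply, Pi.zero_apply, Pi.natCast_apply, zero_sub, zero_add] at h1 h2
      rw [abs_le]; constructor <;> linarith
    obtain ⟨h0, h1⟩ := abs_sub_le_of_rootFrame_mem t hσ hs hb
    exact hnear w h0 h1
  have hQπ : ∀ w ∈ pgramPrismFin G φ t nL hL (3 * ℓ') Rl, w ∈ graphBall G t Rπ := fun w hw =>
    graphBall_mono G t hRlπ (pgramPrism_subset_graphBall t nL hL (3 * ℓ') Rl ((mem_pgramPrismFin G φ).1 hw))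
  -- (2) the hop's landing inside core `0` of the bridge
  have hT₀ : ∀ w ∈ pgSideHalfW G φ t nL hL ℓ' Rl σ 1, w ∈ graphBall G t Rπ ∧ rootFrame φ t σ w ∈ Finset.Icc B.B₀lo B.B₀hi := fun w hw => by
    refine ⟨hQπ w ((mem_pgramPrismFin G φ).2 (coe_pgSideHalfW_subset (G := G) (φ := φ) t nL hL ℓ' Rl σ 1 (Finset.mem_coe.2 hw))), hB0 ?_⟩
    have hb := rootFrame_mem_box_of_sideHalf_same t hσ hnL (h := hL) (ℓ := ℓ') (R := Rl) (τ := 1) (Or.inl rfl) hw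
    rw [rootFrame_self, zero_add, zero_add, one_mul, min_eq_left (by positivity : (0 : ℤ) ≤ ℓ'), max_eq_right (by positivity : (0 : ℤ) ≤ ℓ'), add_zero] at hb
    exact hb
  -- (3) the run's regions and last core
  have hreadP : ∀ w, runX φ cL nL hL σ w ∈ SN.prism → FootBox flo fhi fw du (FS w) := fun w hw => by
    have hw' := runX_sign_mem_Icc cL hnL hL hσ (hprism hw)
    refine footBox_of_runX_mem_Icc t hAf hnL hmf hc0 hc1 hDf cL (LO := PLO) (HI := PHI) ?_ ?_ ?_ ?_ hPf₁ hPf₂ hPf₃ hw'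
    · rw [he0]; simpa only [pt_zero, pt_one] using hP0
    · rw [he0]; simpa only [pt_zero, pt_one] using hP1
    · rw [he1]; simpa only [pt_zero, pt_one] using hP2
    · rw [he1]; simpa only [pt_zero, pt_one] using hP3
  have hfoot₂ : ∀ k ≤ Nr, ∀ w ∈ graphBall G t Rπ, runX φ cL nL hL σ w ∈ SN.region k → FootBox flo fhi fw du (FS w) :=
    fun k hk w _ hw => hreadP w (SN.sub_prism k hk hw)
  have hlastf : ∀ w ∈ graphBall G t Rπ, runX φ cL nL hL σ w ∈ SN.core (Nr + 1) → FootBox glo ghi gw du (FS w) := fun w _ hw => by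
    have hw' := runX_sign_mem_Icc cL hnL hL hσ (hlastc hw)
    refine footBox_of_runX_mem_Icc t hAf hnL hmf hc0 hc1 hDf cL (LO := LLO) (HI := LHI) ?_ ?_ ?_ ?_ hLg₁ hLg₂ hLg₃ hw'
    · rw [he0]; simpa only [pt_zero, pt_one] using hL0
    · rw [he0]; simpa only [pt_zero, pt_one] using hL1
    · rw [he1]; simpa only [pt_zero, pt_one] using hL2
    · rw [he1]; simpa only [pt_zero, pt_one] using hL3
  -- (4) clearances
  have hAk : ∀ a ∈ A, |rootFrame φ t σ a 0| ≤ kb := fun a ha => by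
    rw [rootFrame_apply_zero, abs_mul, hσabs, one_mul]; exact hAφ a ha
  have hclear₂ : ∀ k ≤ Nr, ∀ w ∈ graphBall G t Rπ, runX φ cL nL hL σ w ∈ SN.region k → (kb : ℤ) < rootFrame φ t σ w 0 := by
    intro k hk w _ hw
    have hp := hprism (SN.sub_prism k hk hw)
    rw [mem_Icc_pt_iff] at hp
    have h0 := hp.1.1
    rw [hrun0] at h0
    linarith
  -- (5) the cross link
  have hx : ∀ w ∈ graphBall G t Rπ, rootFrame φ t σ w ∈ Finset.Icc B.core1Lo B.core1Hi → runX φ cL nL hL σ w ∈ SN.core 0 := by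
    intro w _ hw
    rw [hSN, xRunSched, mem_scheduleN_core_iff (xPrmW_ok nL ℓ' hL R's qB Nr) (xPrmW_eb nL ℓ' hL R's qB Nr), RunPrm.inCore_zero_iff, hrun0, hrun1]
    have ha := abs_le.1 (hxa _ hw)
    have hb := hxb _ hw
    set sv := σ * ((nL : ℤ) * (rootFrame φ t σ w 1 - yL 1) - hL * (σ * rootFrame φ t σ w 0 - yL 0)) with hsv
    have hW : (((nL * ℓ' / shearUnit nL hL + 1 : ℕ) : ℤ)) = ((xPrmW nL ℓ' hL R's qB Nr).Wm : ℤ) := by simp [xPrmW]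
    have hW' : (((nL * ℓ' / shearUnit nL hL + 1 : ℕ) : ℤ)) = ((xPrmW nL ℓ' hL R's qB Nr).Wp : ℤ) := by simp [xPrmW]
    have hq : ((xPrmW nL ℓ' hL R's qB Nr).q : ℤ) = qB := by simp [xPrmW]
    rw [hq, ← hW, ← hW']
    have hsv' := abs_le.1 (show |sv| ≤ ((nL * ℓ' / shearUnit nL hL + 1 : ℕ) : ℤ) * shearUnit nL hL - shearUnit nL hL by linarith)
    refine ⟨ha.1, ha.2, ?_, ?_⟩
    · rw [Int.le_ediv_iff_mul_le hU0]
      linarith [hsv'.1]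
    · have hlt : sv / (shearUnit nL hL : ℤ) < ((nL * ℓ' / shearUnit nL hL + 1 : ℕ) : ℤ) + 1 := by
        rw [Int.ediv_lt_iff_lt_mul hU0]; linarith [hsv'.2]
      omega
  -- (6) nonempty targets
  have hTne₁ : (Win G (rootFrame φ t σ) t (Finset.Icc B.core1Lo B.core1Hi) Rπ).Nonempty := by
    obtain ⟨g, hg, hφg⟩ := exists_mem_graphBall_φ_eq hstep t (φ t + pt (σ * B.core1Lo 0) (B.core1Lo 1))
    refine ⟨g, (mem_Win G _).2 ⟨graphBall_mono G t ?_ hg, ?_⟩⟩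
    · simp only [Pi.add_apply, pt_zero, pt_one, add_sub_cancel_left]
      rw [Int.natAbs_mul, show σ.natAbs = 1 by rcases hσ with h | h <;> simp [h], one_mul]
      exact hπ1
    · have h0 : rootFrame φ t σ g 0 = B.core1Lo 0 := by
        rw [rootFrame_apply_zero, hφg, Pi.add_apply, pt_zero]; rw [show φ t 0 + σ * B.core1Lo 0 - φ t 0 = σ * B.core1Lo 0 by ring, ← mul_assoc, hσsq, one_mul]
      have h1 : rootFrame φ t σ g 1 = B.core1Lo 1 := by
        rw [rootFrame_apply_one, hφg, Pi.add_apply, pt_one]; ring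
      have hg' : rootFrame φ t σ g = B.core1Lo := by funext i; fin_cases i <;> assumption
      rw [hg']
      exact Finset.mem_Icc.2 ⟨le_rfl, BridgePrm.core1Lo_le_core1Hi hB⟩
  have hTne₂ : ∀ k ≤ Nr, (Win G (runX φ cL nL hL σ) t (SN.core (k + 1)) Rπ).Nonempty := by
    intro k hk
    obtain ⟨g, hg, hφg⟩ := exists_mem_graphBall_φ_eq hstep cL (φ cL + pt (σ * (((k + 1 : ℕ) : ℤ) * nL)) (σ * (((k + 1 : ℕ) : ℤ) * hL)))
    refine ⟨g, (mem_Win G _).2 ⟨?_, ?_⟩⟩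
    · -- window position: `dist(t, g) ≤ RcL + (k+1)·U ≤ Rπ`
      have hg' : g ∈ graphBall G cL ((k + 1) * shearUnit nL hL) := by
        refine graphBall_mono G cL (le_of_eq ?_) hg
        simp only [Pi.add_apply, pt_zero, pt_one, add_sub_cancel_left, Int.natAbs_mul, show σ.natAbs = 1 by rcases hσ with h | h <;> simp [h], one_mul,
          Int.natAbs_natCast]
        unfold shearUnit; ring
      have h := BoxProdZ2.mem_graphBall_add G hcLπ hg'
      refine graphBall_mono G t ?_ h
      have : (k + 1) * shearUnit nL hL ≤ (Nr + 1) * shearUnit nL hL := Nat.mul_le_mul_right _ (by omega)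
      omega
    · rw [hSN, xRunSched, mem_scheduleN_core_iff (xPrmW_ok nL ℓ' hL R's qB Nr) (xPrmW_eb nL ℓ' hL R's qB Nr)]
      have h0 : runX φ cL nL hL σ g 0 = ((k + 1 : ℕ) : ℤ) * nL := by
        rw [runX_zero, relCoord_apply, hφg, Pi.add_apply, pt_zero]
        rw [show φ cL 0 + σ * (((k + 1 : ℕ) : ℤ) * ↑nL) - φ cL 0 = σ * (((k + 1 : ℕ) : ℤ) * ↑nL) by ring, ← mul_assoc, hσsq, one_mul]
      have h1 : runX φ cL nL hL σ g 1 = 0 := by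
        rw [runX_one, shearCoord_apply, hφg, Pi.add_apply, Pi.add_apply, pt_zero, pt_one]
        rw [show σ * (↑nL * (φ cL 1 + σ * (((k + 1 : ℕ) : ℤ) * hL) - φ cL 1) - hL * (φ cL 0 + σ * (((k + 1 : ℕ) : ℤ) * ↑nL) - φ cL 0)) = 0 by ring]
        simp
      rw [h0, h1]
      have hnom := RunPrm.inCore_nominal (xPrmW_ok nL ℓ' hL R's qB Nr) (k + 1)
      have hs : ((xPrmW nL ℓ' hL R's qB Nr).sLo : ℤ) = nL := rfl
      have hd : ((xPrmW nL ℓ' hL R's qB Nr).d : ℤ) = 0 := rfl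
      rw [hs, hd, mul_zero] at hnom
      exact hnom
  -- assemble
  exact rootOblTWAt_of_inputsG3_x hlipφ hstep hfr hκ hΔg S hroot du hσ (fun w => FootBox flo fhi fw du (FS w))
    (fun w => FootBox glo ghi gw du (FS w)) hUfoot hMfoot htA hAconn hAρ hρπ hAQ hAk B hB hnL cL hL hκL ℓ' R's qB Nr Rl Rlev₁ N₁ j₀₁ j₁₁ Rlev₂ N₂ j₀₂ j₁₂
    hRl₁ hRl₂ hj₁ hj₂ hfoot₁ hfoot₂ hclr₁ hclear₂ hTne₁ hTne₂ hx hlastf hδr hlink hQπ hQfoot hT₀ hcount₁ hcount₂ hη Pb Pr hPNb hAb hd1b hD1b hD2b hDρb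
    hℓb hWb hKmaxb hKCmaxb hR'b hwideb hdwb hDwb hTb hT'b hr₀b hRb₀ hrsb hcSb hEb hreachb hr₁ hr₁R hPNr hAr hd1r hD1r hD2r hDρr hℓr hWr hKmaxr hKCmaxr hR'r
    hwider hdwr hDwr hTr hT'r hr₀r hRr₀ hrsr hcSr hEr hreachr hr₂ hr₂R QK hRgRs hRgcard hcU1 hnSK hκSK hℓSK hκL10 Λc kz hkn hΛ hZ hMz
    Qb Fb hQb hFb hFZ kk₁ kk₂ hkN₁ hkN₂ hk₁ hk₂ hzone hexitb hexitr hbridge hlong hR₁ hR₁b hR₁r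

end Skelφ

end Transplant

end Summit.CriticalPhenomena.PercolationContinuityZ3.Theorems

end
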